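import Literature.Geometry.Kaehler.DolbeaultChartAcyclic
import Literature.Geometry.Kaehler.ConnectionExists
import Literature.NumberTheory.Transcendental.DolbeaultIntegrabilityProofs
import Literature.NumberTheory.Transcendental.ComplexFormsProofs
import Literature.NumberTheory.Transcendental.KaehlerHodgeTypeProofs
import HarnessLib

/-!
# Holomorphic functions and `∂̄` of functions: Cauchy–Riemann at the points of an open set

Layer `Literature/Geometry/Kaehler`. Pointwise Cauchy–Riemann calculus for complex functions on a
complex manifold `M` viewed as `0`-forms (`MForm.ofFun`), at the points of an OPEN set (the tree's
global statement `dolbeaultBar_eq_zero_iff_mdifferentiable` concerns everywhere-`C¹` functions;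
sections of line bundles and Čech cochains are functions on open subsets only):

* `dolbeaultBar_zeroForm` — `∂̄f = (df)^{0,1}` for a `0`-form (every `0`-form has type `(0,0)`);
  `apply_eq_typeComponent_add`, `mextDeriv_zeroForm_apply` — `d = ∂ + ∂̄` on `0`-forms, pointwise;
* `typeComponent_zero_one_apply_eq_zero_iff` — the `(0,1)`-component of a `1`-form at `x` vanishes
  iff the form is rotation-equivariant of weight `1` at `x` (i.e. `ℂ`-linear);
* **`mdifferentiableOn_of_dolbeaultBar_ofFun_eq_zero`** — a function real-`C^∞` at the points of `V`
  with `∂̄f = 0` there is holomorphic on `V`; **`dolbeaultBar_ofFun_eq_zero_of_mdifferentiableOn`** —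
  conversely `∂̄f = 0` at the points of an open set of holomorphy (Voisin I, §2.3.3, Lemma 2.29;
  Griffiths–Harris p. 2); `dolbeault_ofFun_eq_mextDeriv_of_mdifferentiableOn` — `∂f = df` there;
* `MForm.typeComponent_congr_apply` — the type projections are POINTWISE operators;
* **`dolbeaultBar_ofFun_mul_of_mdifferentiableOn`** — the Leibniz rule with a holomorphic factor:
  `∂̄(g f) = g ∂̄f` at the points of an open set on which `g` is holomorphic, for `f` real-`C^∞`
  there (`∂̄(gf) = f ∂̄g + g ∂̄f` and `∂̄g = 0`) — the identity that makes the sheaf of sections of a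
  holomorphic cocycle line bundle a `∂̄`-stable 𝒪-module (the twisted Čech–Dolbeault comparison).

Everything is proved. The first five items re-home, in the Literature, lemmas first written in the
route file `Summits/HodgeConjecture/HodgeConjecture/Theorems/NikulinTwinTransportLefschetzOneOneK3Holomorphy`
(same statements and proofs; Summits files cannot be imported here), so that Literature files may
use them.

## References

* C. Voisin, *Hodge Theory and Complex Algebraic Geometry I* (2002), §2.3.1, §2.3.3 (Lemma 2.29).
  [VoisinHodgeI2002]
* P. Griffiths, J. Harris, *Principles of Algebraic Geometry* (1978), p. 2. [GriffithsHarris1978]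
* F. W. Warner, *Foundations of Differentiable Manifolds and Lie Groups* (1983), 2.20. [WarnerGTM94]
-/

noncomputable section

open scoped Manifold ContDiff Topology
open Set Filter Function
open Literature.NumberTheory.Transcendental

namespace Literature.Geometry.Kaehler

variable {E : Type*} [NormedAddCommGroup E] [NormedSpace ℂ E]
  {M : Type*} [TopologicalSpace M] [ChartedSpace E M]

/-! ### `0`-forms: `∂̄f = (df)^{0,1}`, `d = ∂ + ∂̄` -/

/-- `∂̄` of a `0`-form is the `(0,1)`-component of its differential (a `0`-form has type `(0,0)`).
[cite: VoisinHodgeI2002, §2.3.3] -/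
theorem dolbeaultBar_zeroForm (φ : MForm 𝓘(ℝ, E) M ℂ 0) :
    dolbeaultBar φ = (mextDeriv φ).typeComponent 0 1 :=
  IsOfType.dolbeaultBar_eq_holds (isOfType_zero_zero φ)

/-- `∂` of a `0`-form is the `(1,0)`-component of its differential. [cite: VoisinHodgeI2002, §2.3.3] -/
theorem dolbeault_zeroForm (φ : MForm 𝓘(ℝ, E) M ℂ 0) :
    dolbeault φ = (mextDeriv φ).typeComponent 1 0 :=
  IsOfType.dolbeault_eq_holds (isOfType_zero_zero φ)

/-- **Type decomposition of a `1`-form at a point**: `γ_x = γ^{1,0}_x + γ^{0,1}_x`.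
[cite: VoisinHodgeI2002, §2.3.1] -/
theorem apply_eq_typeComponent_add (γ : MForm 𝓘(ℝ, E) M ℂ 1) (x : M) :
    γ x = γ.typeComponent 1 0 x + γ.typeComponent 0 1 x := by
  have h := congrFun (sum_antidiagonal_typeComponent_holds γ) x
  rw [Finset.sum_apply, Finset.sum_eq_add (1, 0) (0, 1) (by simp)] at h
  · exact h.symm
  · rintro ⟨a, b⟩ hc hne
    simp only [Finset.mem_antidiagonal] at hc
    simp only [ne_eq, Prod.mk.injEq, not_and] at hne
    omega
  · simp
  · simp

/-- `d = ∂ + ∂̄` on `0`-forms, pointwise and unconditionally. [cite: VoisinHodgeI2002, §2.3.1] -/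
theorem mextDeriv_zeroForm_apply (φ : MForm 𝓘(ℝ, E) M ℂ 0) (x : M) :
    mextDeriv φ x = dolbeault φ x + dolbeaultBar φ x := by
  rw [dolbeault_zeroForm, dolbeaultBar_zeroForm]
  exact apply_eq_typeComponent_add (mextDeriv φ) x

/-- **The type projections are pointwise operators**: `α^{p,q}_x` depends only on `α_x`.
[cite: VoisinHodgeI2002, §2.3.1] -/
theorem MForm.typeComponent_congr_apply {k : ℕ} (p q : ℕ) {α β : MForm 𝓘(ℝ, E) M ℂ k} {x : M}
    (h : α x = β x) : α.typeComponent p q x = β.typeComponent p q x := by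
  unfold MForm.typeComponent MForm.weightComponent
  split_ifs
  · simp only [h]
  · rfl

/-! ### The `(0,1)`-component of a `1`-form at a point -/

/-- **The `(0,1)`-component of a `1`-form at `x` vanishes iff the form is rotation-equivariant of
weight `1` at `x`**: `β_x(e^{iθ} v) = e^{iθ} β_x(v)` (i.e. `β_x` is `ℂ`-linear). (→): `β = β^{1,0} +
β^{0,1}` and `β^{1,0}` transforms with weight `1`; (←): the weight `-1` Fourier average of a
weight-`1` function is `(1/3) ∑_j e^{2iθ_j} = 0`. [cite: VoisinHodgeI2002, §2.3.1] -/
theorem typeComponent_zero_one_apply_eq_zero_iff (β : MForm 𝓘(ℝ, E) M ℂ 1) (x : M) :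
    β.typeComponent 0 1 x = 0 ↔
      ∀ (θ : ℝ) (v : Fin 1 → TangentSpace 𝓘(ℝ, E) x),
        β x (⇑(tangentRotate E x θ) ∘ v) = Complex.exp (θ * Complex.I) * β x v := by
  constructor
  · intro h0 θ v
    have h10 : IsOfType 1 0 (β.typeComponent 1 0) :=
      isOfType_typeComponent_holds (p := 1) (q := 0) rfl β
    have key := h10.2 x θ v
    have hsum := apply_eq_typeComponent_add β x
    rw [h0, add_zero] at hsum
    have e1 : (((1 : ℕ) : ℤ) - ((0 : ℕ) : ℤ) : ℤ) = 1 := by norm_num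
    rw [e1, Int.cast_one, one_mul] at key
    rw [hsum]
    exact key
  · intro h
    rw [MForm.typeComponent, if_pos rfl]
    ext v
    simp only [MForm.weightComponent, ContinuousAlternatingMap.smul_apply,
      ContinuousAlternatingMap.sum_apply, ContinuousAlternatingMap.compContinuousLinearMap_apply,
      ContinuousAlternatingMap.coe_zero, Pi.zero_apply, smul_eq_mul, h]
    rw [Finset.sum_congr rfl (g := fun j : Fin (2 * 1 + 1) ↦
      Complex.exp (((2 : ℤ) : ℂ) * ((2 * Real.pi * (j : ℕ) / (2 * ((1 : ℕ) : ℝ) + 1) : ℝ) : ℂ) *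
        Complex.I) * β x v) (fun j _ ↦ by
          rw [← mul_assoc, ← Complex.exp_add]
          congr 2
          push_cast
          ring),
      ← Finset.sum_mul, sum_exp_mul_rootAngle_mul_I_eq_zero (k := 1) (d := 2) (by norm_num)
        (by norm_num), zero_mul, mul_zero]

/-! ### Functions: the differential as a `1`-form and the chart derivative -/

variable [IsManifold 𝓘(ℝ, E) ∞ M]

/-- The chart derivative of `f` at `x`: `df_x(v) = D(f ∘ φₓ⁻¹)(φₓ x) v`. [cite: WarnerGTM94, 2.20] -/
theorem mextDeriv_ofFun_apply' (f : M → ℂ) (x : M) (v : Fin 1 → TangentSpace 𝓘(ℝ, E) x) :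
    mextDeriv (MForm.ofFun 𝓘(ℝ, E) f) x v =
      fderiv ℝ (f ∘ (extChartAt 𝓘(ℝ, E) x).symm) (extChartAt 𝓘(ℝ, E) x x) (v 0) := by
  rw [mextDeriv_ofFun_apply, ModelWithCorners.Boundaryless.range_eq_univ, fderivWithin_univ]

/-- Rotation-equivariance of `df` at `x` is rotation-equivariance of the chart derivative.
[folklore] -/
theorem mextDeriv_ofFun_rotate_iff (f : M → ℂ) (x : M) :
    (∀ (θ : ℝ) (v : Fin 1 → TangentSpace 𝓘(ℝ, E) x),
        mextDeriv (MForm.ofFun 𝓘(ℝ, E) f) x (⇑(tangentRotate E x θ) ∘ v) =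
          Complex.exp (θ * Complex.I) * mextDeriv (MForm.ofFun 𝓘(ℝ, E) f) x v) ↔
      ∀ (θ : ℝ) (w : E),
        fderiv ℝ (f ∘ (extChartAt 𝓘(ℝ, E) x).symm) (extChartAt 𝓘(ℝ, E) x x)
            (Complex.exp (θ * Complex.I) • w) =
          Complex.exp (θ * Complex.I) *
            fderiv ℝ (f ∘ (extChartAt 𝓘(ℝ, E) x).symm) (extChartAt 𝓘(ℝ, E) x x) w := by
  constructor
  · intro h θ w
    have := h θ ![w]
    rw [mextDeriv_ofFun_apply', mextDeriv_ofFun_apply'] at this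
    exact this
  · intro h θ v
    rw [mextDeriv_ofFun_apply', mextDeriv_ofFun_apply']
    exact h θ (v 0)

omit [ChartedSpace E M] [IsManifold 𝓘(ℝ, E) ∞ M] in
/-- A real continuous linear functional on a complex space which is equivariant under the circle
`e^{iθ}` is `ℂ`-linear. [folklore] -/
theorem exists_restrictScalars_eq_of_rotate {D : E →L[ℝ] ℂ}
    (h : ∀ (θ : ℝ) (w : E), D (Complex.exp (θ * Complex.I) • w) = Complex.exp (θ * Complex.I) * D w) :
    ∃ g : E →L[ℂ] ℂ, g.restrictScalars ℝ = D := by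
  have hc : ∀ (c : ℂ) (w : E), D (c • w) = c * D w := by
    intro c w
    have hpolar : c = (‖c‖ : ℂ) * Complex.exp (Complex.arg c * Complex.I) :=
      (Complex.norm_mul_exp_arg_mul_I c).symm
    rw [hpolar, mul_smul, Complex.coe_smul, D.map_smul, h, Complex.real_smul, mul_assoc]
  refine ⟨{ toFun := D, map_add' := D.map_add, map_smul' := hc, cont := D.cont }, ?_⟩
  ext w; rfl

/-! ### `∂̄f = 0` at the points of an open set iff `f` is holomorphic there -/

/-- **`∂̄`-closed functions are holomorphic**: if `f` is real-`C^∞` at the points of `V` (as a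
`0`-form) and `∂̄f = 0` there, then `f` is holomorphic on `V`. [cite: VoisinHodgeI2002, §2.3.3 Lemma 2.29] -/
theorem mdifferentiableOn_of_dolbeaultBar_ofFun_eq_zero {V : Set M} {f : M → ℂ}
    (hf : ∀ x ∈ V, (MForm.ofFun 𝓘(ℝ, E) f).SmoothAt x)
    (h0 : ∀ x ∈ V, dolbeaultBar (MForm.ofFun 𝓘(ℝ, E) f) x = 0) :
    MDifferentiableOn 𝓘(ℂ, E) 𝓘(ℂ, ℂ) f V := by
  intro x hx
  -- real differentiability in the chart at `x`
  have hsm : ContDiffAt ℝ ∞ (f ∘ (extChartAt 𝓘(ℝ, E) x).symm) (extChartAt 𝓘(ℝ, E) x x) := by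
    have h := (MForm.smoothAt_ofFun_iff (I := 𝓘(ℝ, E)) f x).1 (hf x hx)
    rwa [ModelWithCorners.Boundaryless.range_eq_univ, contDiffWithinAt_univ] at h
  have hdR : DifferentiableAt ℝ (f ∘ (extChartAt 𝓘(ℝ, E) x).symm) (extChartAt 𝓘(ℝ, E) x x) :=
    hsm.differentiableAt (by simp)
  -- the chart derivative is `ℂ`-linear
  have hrot := (mextDeriv_ofFun_rotate_iff f x).1
    ((typeComponent_zero_one_apply_eq_zero_iff (mextDeriv (MForm.ofFun 𝓘(ℝ, E) f)) x).1
      (by rw [← dolbeaultBar_zeroForm]; exact h0 x hx))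
  obtain ⟨g, hg⟩ := exists_restrictScalars_eq_of_rotate hrot
  have hdC : DifferentiableAt ℂ (f ∘ (extChartAt 𝓘(ℝ, E) x).symm) (extChartAt 𝓘(ℝ, E) x x) :=
    (differentiableAt_iff_restrictScalars ℝ hdR).2 ⟨g, hg⟩
  -- back to the manifold
  have hcont : ContinuousAt f x := by
    have h1 : ContinuousAt (f ∘ (extChartAt 𝓘(ℝ, E) x).symm) (extChartAt 𝓘(ℝ, E) x x) :=
      hdC.continuousAt
    have h2 : ContinuousAt (extChartAt 𝓘(ℝ, E) x) x := continuousAt_extChartAt x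
    have h3 := h1.comp h2
    refine h3.congr ?_
    filter_upwards [extChartAt_source_mem_nhds (I := 𝓘(ℝ, E)) x] with y hy
    simp only [Function.comp_apply]
    rw [(extChartAt 𝓘(ℝ, E) x).left_inv hy]
  have hmd : MDifferentiableAt 𝓘(ℂ, E) 𝓘(ℂ, ℂ) f x := by
    rw [mdifferentiableAt_iff (I := 𝓘(ℂ, E)) (I' := 𝓘(ℂ, ℂ)) f x]
    refine ⟨hcont, ?_⟩
    simp only [writtenInExtChartAt, extChartAt_model_space_eq_id, PartialEquiv.refl_coe,
      Function.id_comp, ModelWithCorners.Boundaryless.range_eq_univ, differentiableWithinAt_univ]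
    exact hdC
  exact hmd.mdifferentiableWithinAt

/-- **Holomorphic functions are `∂̄`-closed**: `∂̄f = 0` at the points of an open set on which `f`
is holomorphic. [cite: VoisinHodgeI2002, §2.3.3 Lemma 2.29] -/
theorem dolbeaultBar_ofFun_eq_zero_of_mdifferentiableOn {V : Set M} (hV : IsOpen V) {f : M → ℂ}
    (hf : MDifferentiableOn 𝓘(ℂ, E) 𝓘(ℂ, ℂ) f V) {x : M} (hx : x ∈ V) :
    dolbeaultBar (MForm.ofFun 𝓘(ℝ, E) f) x = 0 := by
  rw [dolbeaultBar_zeroForm, typeComponent_zero_one_apply_eq_zero_iff, mextDeriv_ofFun_rotate_iff]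
  have hdC : DifferentiableAt ℂ (f ∘ (extChartAt 𝓘(ℝ, E) x).symm) (extChartAt 𝓘(ℝ, E) x x) :=
    differentiableAt_comp_extChartAt_symm_of_mdifferentiableAt
      ((hf x hx).mdifferentiableAt (hV.mem_nhds hx))
  intro θ w
  rw [hdC.fderiv_restrictScalars ℝ, ContinuousLinearMap.coe_restrictScalars', map_smul, smul_eq_mul]

/-- **`∂f = df` for holomorphic `f`** (pointwise on the open set of holomorphy). [cite: VoisinHodgeI2002, §2.3.3] -/
theorem dolbeault_ofFun_eq_mextDeriv_of_mdifferentiableOn {V : Set M} (hV : IsOpen V) {f : M → ℂ}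
    (hf : MDifferentiableOn 𝓘(ℂ, E) 𝓘(ℂ, ℂ) f V) {x : M} (hx : x ∈ V) :
    dolbeault (MForm.ofFun 𝓘(ℝ, E) f) x = mextDeriv (MForm.ofFun 𝓘(ℝ, E) f) x := by
  rw [mextDeriv_zeroForm_apply, dolbeaultBar_ofFun_eq_zero_of_mdifferentiableOn hV hf hx, add_zero]

/-- A holomorphic function on an open set is real-`C^∞` as a `0`-form at its points.
[cite: VoisinHodgeI2002, §1.2.1 Thm. 1.17] -/
theorem smoothAt_ofFun_of_mdifferentiableOn [FiniteDimensional ℂ E] [IsManifold 𝓘(ℂ, E) ω M]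
    {V : Set M} (hV : IsOpen V)
    {g : M → ℂ} (hg : MDifferentiableOn 𝓘(ℂ, E) 𝓘(ℂ, ℂ) g V) {x : M} (hx : x ∈ V) :
    (MForm.ofFun 𝓘(ℝ, E) g).SmoothAt x := by
  rw [MForm.smoothAt_ofFun_iff]
  have h := (contMDiffOn_real_of_mdifferentiableOn_complex hg hV).contMDiffAt (hV.mem_nhds hx)
  simpa using (contMDiffAt_iff.1 h).2

/-! ### The Leibniz rule with a holomorphic factor: `∂̄(g f) = g ∂̄f` -/

/-- **`∂̄(g f) = g ∂̄f` for `g` holomorphic**: at a point `x` of an open set `V` on which `g` is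
holomorphic, and for `f` real-`C^∞` at `x`, `∂̄(gf)_x = g(x) (∂̄f)_x` (Leibniz `d(gf) = f dg + g df`
at `x`, the type projection is pointwise and `ℂ`-linear, and `(dg)^{0,1}_x = ∂̄g_x = 0`). This is the
identity making the sheaf of holomorphic sections of a cocycle line bundle (frames related by
holomorphic `g_ij`) stable under `∂̄` computed framewise. [cite: VoisinHodgeI2002, §2.3.3 Lemma 2.29] -/
theorem dolbeaultBar_ofFun_mul_of_mdifferentiableOn [FiniteDimensional ℂ E] [IsManifold 𝓘(ℂ, E) ω M]
    {V : Set M} (hV : IsOpen V)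
    {g f : M → ℂ} (hg : MDifferentiableOn 𝓘(ℂ, E) 𝓘(ℂ, ℂ) g V) {x : M} (hx : x ∈ V)
    (hf : ContMDiffAt 𝓘(ℝ, E) 𝓘(ℝ, ℂ) ∞ f x) :
    dolbeaultBar (MForm.ofFun 𝓘(ℝ, E) fun y ↦ g y * f y) x =
      g x • dolbeaultBar (MForm.ofFun 𝓘(ℝ, E) f) x := by
  have hgx : ContMDiffAt 𝓘(ℝ, E) 𝓘(ℝ, ℂ) ∞ g x :=
    (contMDiffOn_real_of_mdifferentiableOn_complex hg hV).contMDiffAt (hV.mem_nhds hx)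
  -- Leibniz at `x`, as an identity of `1`-forms evaluated at `x`
  have hpt : mextDeriv (MForm.ofFun 𝓘(ℝ, E) fun y ↦ g y * f y) x =
      (f x • mextDeriv (MForm.ofFun 𝓘(ℝ, E) g) + g x • mextDeriv (MForm.ofFun 𝓘(ℝ, E) f)) x := by
    ext v
    rw [mextDeriv_ofFun_mul_apply hgx hf v, Pi.add_apply, Pi.smul_apply, Pi.smul_apply,
      ContinuousAlternatingMap.add_apply, ContinuousAlternatingMap.smul_apply,
      ContinuousAlternatingMap.smul_apply]
  have hg0 : (mextDeriv (MForm.ofFun 𝓘(ℝ, E) g)).typeComponent 0 1 x = 0 := by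
    rw [← dolbeaultBar_zeroForm]
    exact dolbeaultBar_ofFun_eq_zero_of_mdifferentiableOn hV hg hx
  rw [dolbeaultBar_zeroForm, dolbeaultBar_zeroForm, MForm.typeComponent_congr_apply 0 1 hpt,
    MForm.typeComponent_add, MForm.typeComponent_smul, MForm.typeComponent_smul, Pi.add_apply,
    Pi.smul_apply, Pi.smul_apply, hg0, smul_zero]
  exact zero_add _

end Literature.Geometry.Kaehler
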